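import Mathlib
import HarnessLib
import Literature.MathematicalPhysics.AQFT.OSAxiomsSchwinger
import Literature.MathematicalPhysics.QuantumLattice.SchwartzHalfSpaceCutoffA

/-!
# Block CUTOFF of line `conditional-mean-telescoping` (crux stmt-QuantumFields-8646): smooth slice
cutoff of an off-diagonal test function

For every arity `n`, order `s` and decay exponent `N` there is a constant `Cst` (depending on
`n, s` only) such that: for `0 < a ≤ 1`, `T ≤ -2`, a set `ℓ` of selected arguments and `F ∈ ⁰𝒮ₙ`
there is `G ∈ ⁰𝒮ₙ` which agrees with `F` wherever some selected argument has time `≤ T`, vanishes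
wherever all selected arguments have time `≥ T + a/4`, and
`|G|_s ≤ Cst · a⁻ˢ · (|T| − 1)⁻ᴺ · |F|_{s+N}` in the tree's Schwartz norms `schwartzNorm`.

Proof.  `G = χ • F` with the product cutoff `χ(y) = 1 − ∏_{l ∈ ℓ} σ(c (y_l⁰ − T))`, `c = 4/a`,
`σ = Real.smoothTransition`.  Writing `χ = χ̃ ∘ (c • ·)` with `χ̃(z) = 1 − ∏_{l ∈ ℓ} σ(z_l⁰ − cT)`, a
product of at most `n` smooth steps along coordinate forms of norm `≤ 1`, the derivatives of `χ̃`
are bounded independently of `a, T, ℓ` (`exists_bound_iteratedFDeriv_smoothTransition`,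
`exists_bound_iteratedFDeriv_prod`, `norm_iteratedFDeriv_one_sub_le`), and the scaling costs `c^j`
(`iteratedFDeriv_comp_const_smul`), `c^j ≤ c^s = 4^s a^{-s}` for `j ≤ s`.  Multiplication by the
temperate `χ` preserves `⁰𝒮` (`isOffDiagonal_smulLeftCLM`).  For the norm bound fix `(k, l) ≤ (s, s)`
and a point `y`: if all selected times are `> T + a/4` then `χ • F` vanishes near `y`; otherwise
`‖y‖ ≥ |y_l⁰| ≥ |T| − 1 ≥ 1` for some `l ∈ ℓ` and the weighted Leibniz bound with polynomial gain
(`pow_mul_norm_iteratedFDeriv_smul_le_inv_pow`) gives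
`‖y‖^k ‖D^l(χ F)(y)‖ ≤ 2^l B₀ c^s (|T| − 1)^{-N} sup_{≤ (k+N, l)} ‖F‖`.
-/

noncomputable section

open scoped SchwartzMap ContDiff
open Filter Topology
open Literature.MathematicalPhysics.AQFT Literature.MathematicalPhysics.QuantumLattice

namespace Summit.QuantumFields.YangMills.Cruxes.HypercubicLimit.ConditionalMeanTelescoping

/-- **Block CUTOFF (smooth slice cutoff of an off-diagonal test function).** For every arity `n`, order
`s` and decay exponent `N` there is a constant such that: for `0 < a ≤ 1`, `T ≤ −2`, a set `ℓ` of
arguments and `F ∈ ⁰𝒮ₙ`, there is `G ∈ ⁰𝒮ₙ` which AGREES with `F` wherever some selected argument has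
time `≤ T`, VANISHES wherever all selected arguments have time `≥ T + a/4`, and whose Schwartz norm of
order `s` is at most `Cst · a⁻ˢ · (|T| − 1)⁻ᴺ · |F|_{s+N}` (product cutoff `1 − ∏_{l∈ℓ} σ((y_l⁰ − T)/(a/4))`
with the smooth step `σ = Real.smoothTransition`, Leibniz rule, and `‖y‖ ≥ |T| − 1` on the support)
(Hörmander, ALPDO I §7.1; Osterwalder–Schrader 1973 §2). [folklore] -/
theorem rpBlock_sliceCutoff :
    ∀ (n s N : ℕ), ∃ Cst : ℝ, 0 ≤ Cst ∧
      ∀ (a T : ℝ) (ℓ : Finset (Fin n)) (F : 𝓢((Fin n → EuclideanSpace ℝ (Fin 4)), ℂ)),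
        0 < a → a ≤ 1 → T ≤ -2 → IsOffDiagonal F →
          ∃ G : 𝓢((Fin n → EuclideanSpace ℝ (Fin 4)), ℂ), IsOffDiagonal G ∧
            (∀ y : Fin n → EuclideanSpace ℝ (Fin 4), (∃ l ∈ ℓ, y l 0 ≤ T) → G y = F y) ∧
            (∀ y : Fin n → EuclideanSpace ℝ (Fin 4), (∀ l ∈ ℓ, T + a / 4 ≤ y l 0) → G y = 0) ∧
            schwartzNorm s G ≤ Cst * a⁻¹ ^ s * (|T| - 1)⁻¹ ^ N * schwartzNorm (s + N) F := by
  intro n s N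
  -- universal derivative bounds: `B j` for the smooth step, `A' j` for products of `≤ n` factors
  choose B hB using exists_bound_iteratedFDeriv_smoothTransition
  obtain ⟨A', hA'⟩ := exists_bound_iteratedFDeriv_prod
    (X := Fin n → EuclideanSpace ℝ (Fin 4)) (ι' := Fin n) B n
  set B0 : ℝ := ∑ i ∈ Finset.range (s + 1), (|A' i| + 1) with hB0_def
  have hB0 : 0 ≤ B0 := Finset.sum_nonneg fun i _ => by positivity
  have hAB0 : ∀ i ≤ s, A' i + 1 ≤ B0 := by
    intro i hi
    have h1 : |A' i| + 1 ≤ B0 :=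
      Finset.single_le_sum (f := fun j => |A' j| + 1) (fun j _ => by positivity)
        (Finset.mem_range.2 (Nat.lt_succ_of_le hi))
    linarith [le_abs_self (A' i)]
  refine ⟨8 ^ s * B0, by positivity, ?_⟩
  intro a T ℓ F ha ha1 hT hF
  -- the scale `c = 4 / a ≥ 1`
  have ha' : a ≠ 0 := ha.ne'
  have hainv : (1 : ℝ) ≤ a⁻¹ := (one_le_inv₀ ha).2 ha1
  set c : ℝ := 4 * a⁻¹ with hc_def
  have hc0 : 0 < c := by positivity
  have hc1 : (1 : ℝ) ≤ c := by rw [hc_def]; linarith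
  -- coordinate forms `crd l y = y l 0`, of norm `≤ 1`
  let crd : Fin n → (Fin n → EuclideanSpace ℝ (Fin 4)) →L[ℝ] ℝ := fun l =>
    (EuclideanSpace.proj (0 : Fin 4)).comp (ContinuousLinearMap.proj l)
  have hcrd : ∀ l y, crd l y = y l 0 := fun _ _ => rfl
  have habs : ∀ (y : Fin n → EuclideanSpace ℝ (Fin 4)) (l : Fin n), |y l 0| ≤ ‖y‖ := by
    intro y l
    have h := PiLp.norm_apply_le (y l) 0
    rw [Real.norm_eq_abs] at h
    exact h.trans (norm_le_pi_norm y l)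
  have hcrd1 : ∀ l, ‖crd l‖ ≤ 1 := fun l =>
    ContinuousLinearMap.opNorm_le_bound _ zero_le_one fun y => by
      rw [one_mul, hcrd, Real.norm_eq_abs]; exact habs y l
  -- unscaled factors `u l z = σ (z l 0 - c T)`, their product `Q` and `χ̃ = 1 - Q`
  let u : Fin n → (Fin n → EuclideanSpace ℝ (Fin 4)) → ℝ := fun l z =>
    Real.smoothTransition (crd l z + -(c * T))
  have hu_smooth : ∀ l, ContDiff ℝ ∞ (u l) := fun l =>
    Real.smoothTransition.contDiff.comp ((crd l).contDiff.add contDiff_const)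
  have hu_bd : ∀ l j z, ‖iteratedFDeriv ℝ j (u l) z‖ ≤ B j := by
    intro l j z
    have hcomp : u l = (fun t => Real.smoothTransition (t + -(c * T))) ∘ (crd l) := rfl
    have hg : ContDiff ℝ ∞ (fun t : ℝ => Real.smoothTransition (t + -(c * T))) :=
      Real.smoothTransition.contDiff.comp (contDiff_id.add contDiff_const)
    rw [hcomp]
    refine (norm_iteratedFDeriv_comp_right_le_of_norm_le_one hg (crd l) (hcrd1 l) j z).trans ?_
    rw [iteratedFDeriv_comp_add_right]
    exact hB j _
  set Q : (Fin n → EuclideanSpace ℝ (Fin 4)) → ℝ := fun z => ∏ l ∈ ℓ, u l z with hQ_def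
  have hQ_smooth : ContDiff ℝ ∞ Q := contDiff_prod fun l _ => hu_smooth l
  have hQ_bd : ∀ j z, ‖iteratedFDeriv ℝ j Q z‖ ≤ A' j :=
    hA' ℓ (by simpa using ℓ.card_le_univ) u (fun l _ => hu_smooth l) (fun l _ j z => hu_bd l j z)
  set χt : (Fin n → EuclideanSpace ℝ (Fin 4)) → ℝ := fun z => 1 - Q z with hχt_def
  have hχt_smooth : ContDiff ℝ ∞ χt := contDiff_const.sub hQ_smooth
  have hχt_bd : ∀ j z, ‖iteratedFDeriv ℝ j χt z‖ ≤ A' j + 1 :=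
    norm_iteratedFDeriv_one_sub_le hQ_smooth hQ_bd
  -- the cutoff `χ = χ̃ ∘ (c • ·)` and its complexification
  set χ : (Fin n → EuclideanSpace ℝ (Fin 4)) → ℝ := fun y => χt (c • y) with hχ_def
  have hχ_smooth : ContDiff ℝ ∞ χ := hχt_smooth.comp (contDiff_const_smul c)
  have hχ_bd : ∀ j y, ‖iteratedFDeriv ℝ j χ y‖ ≤ c ^ j * (A' j + 1) := by
    intro j y
    rw [hχ_def, iteratedFDeriv_comp_const_smul (𝕜 := ℝ) c (hχt_smooth.of_le (mod_cast le_top))]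
    dsimp only
    rw [norm_smul, norm_pow, Real.norm_of_nonneg hc0.le]
    exact mul_le_mul_of_nonneg_left (hχt_bd j _) (by positivity)
  set χc : (Fin n → EuclideanSpace ℝ (Fin 4)) → ℂ := fun y => ((χ y : ℝ) : ℂ) with hχc_def
  have hχc_smooth : ContDiff ℝ ∞ χc := contDiff_complex_ofReal_comp hχ_smooth
  have hχc_bd : ∀ j y, ‖iteratedFDeriv ℝ j χc y‖ ≤ c ^ j * (A' j + 1) := fun j y => by
    rw [hχc_def, norm_iteratedFDeriv_complex_ofReal_comp hχ_smooth]; exact hχ_bd j y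
  have hχc_t : χc.HasTemperateGrowth := hasTemperateGrowth_of_bounds hχc_smooth _ hχc_bd
  -- values of the cutoff
  have hcy : ∀ (y : Fin n → EuclideanSpace ℝ (Fin 4)) (l : Fin n),
      crd l (c • y) + -(c * T) = c * (y l 0 - T) := by
    intro y l; rw [map_smul, hcrd, smul_eq_mul]; ring
  have hχ1 : ∀ y : Fin n → EuclideanSpace ℝ (Fin 4), (∃ l ∈ ℓ, y l 0 ≤ T) → χ y = 1 := by
    rintro y ⟨l, hl, hyl⟩
    have h0 : u l (c • y) = 0 := by
      show Real.smoothTransition _ = 0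
      rw [hcy]
      exact Real.smoothTransition.zero_of_nonpos
        ((mul_le_mul_of_nonneg_left (by linarith : y l 0 - T ≤ 0) hc0.le).trans_eq (mul_zero c))
    show 1 - ∏ l ∈ ℓ, u l (c • y) = 1
    rw [Finset.prod_eq_zero hl h0, sub_zero]
  have hχ0 : ∀ y : Fin n → EuclideanSpace ℝ (Fin 4), (∀ l ∈ ℓ, T + a / 4 ≤ y l 0) → χ y = 0 := by
    intro y hy
    have h1 : ∀ l ∈ ℓ, u l (c • y) = 1 := fun l hl => by
      show Real.smoothTransition _ = 1
      rw [hcy]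
      refine Real.smoothTransition.one_of_one_le ?_
      have h4 : a / 4 ≤ y l 0 - T := by linarith [hy l hl]
      calc (1 : ℝ) = c * (a / 4) := by rw [hc_def]; field_simp
        _ ≤ c * (y l 0 - T) := mul_le_mul_of_nonneg_left h4 hc0.le
    show 1 - ∏ l ∈ ℓ, u l (c • y) = 0
    rw [Finset.prod_eq_one h1, sub_self]
  -- the cutoff test function `G = χ • F`
  refine ⟨SchwartzMap.smulLeftCLM ℂ χc F, isOffDiagonal_smulLeftCLM hχc_t hF, ?_, ?_, ?_⟩
  · intro y hy
    rw [SchwartzMap.smulLeftCLM_apply_apply hχc_t, hχc_def]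
    simp only [hχ1 y hy, Complex.ofReal_one, one_smul]
  · intro y hy
    rw [SchwartzMap.smulLeftCLM_apply_apply hχc_t, hχc_def]
    simp only [hχ0 y hy, Complex.ofReal_zero, zero_smul]
  -- the norm bound
  have hT2 : (2 : ℝ) ≤ |T| := by rw [abs_of_neg (by linarith)]; linarith
  have hR : (0 : ℝ) < |T| - 1 := by linarith
  have hcs : c ^ s = 4 ^ s * a⁻¹ ^ s := by rw [hc_def, mul_pow]
  have hχc_bds : ∀ i ≤ s, ∀ y, ‖iteratedFDeriv ℝ i χc y‖ ≤ B0 * c ^ s := by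
    intro i hi y
    refine (hχc_bd i y).trans ?_
    rw [mul_comm]
    exact mul_le_mul (hAB0 i hi) (pow_le_pow_right₀ hc1 hi) (by positivity) hB0
  unfold schwartzNorm
  refine Seminorm.finset_sup_apply_le (mul_nonneg (by positivity) (apply_nonneg _ _)) ?_
  intro i hi
  obtain ⟨k, l⟩ := i
  obtain ⟨hk, hl⟩ := Prod.mk_le_mk.1 (Finset.mem_Iic.1 hi)
  rw [SchwartzMap.schwartzSeminormFamily_apply]
  have hM0 : 0 ≤ 2 ^ s * B0 * c ^ s * (|T| - 1)⁻¹ ^ N *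
      (Finset.Iic (k + N, l)).sup (schwartzSeminormFamily ℂ (Fin n → EuclideanSpace ℝ (Fin 4)) ℂ) F :=
    mul_nonneg (by positivity) (apply_nonneg _ _)
  refine (SchwartzMap.seminorm_le_bound ℂ k l _ hM0 fun y => ?_).trans ?_
  · rw [SchwartzMap.smulLeftCLM_apply hχc_t]
    by_cases hy : ∀ l' ∈ ℓ, T + a / 4 < y l' 0
    · -- flat region: `χ • F` vanishes near `y`
      have hev : ∀ᶠ z in 𝓝 y, ∀ l' ∈ ℓ, T + a / 4 < z l' 0 :=
        (Filter.eventually_all_finset ℓ).2 fun l' hl' =>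
          (isOpen_lt continuous_const (by fun_prop)).mem_nhds (hy l' hl')
      have heq : (fun z => χc z • F z) =ᶠ[𝓝 y]
          fun _ => (0 : ℂ) :=
        hev.mono fun z hz => by
          simp only [hχc_def, hχ0 z fun l' hl' => (hz l' hl').le, Complex.ofReal_zero, zero_smul]
      rw [(heq.iteratedFDeriv ℝ l).eq_of_nhds, iteratedFDeriv_fun_zero]
      simpa using hM0
    · -- tail region: some selected time is `≤ T + a/4`, so `‖y‖ ≥ |T| - 1`
      push Not at hy
      obtain ⟨l', hl', hyl⟩ := hy
      have hy' : |T| - 1 ≤ ‖y‖ := by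
        have h1 := habs y l'
        have h2 : -(y l' 0) ≤ |y l' 0| := neg_le_abs _
        rw [abs_of_neg (show T < 0 by linarith)]
        linarith
      refine (pow_mul_norm_iteratedFDeriv_smul_le_inv_pow ℂ (l := l) (x := y)
        (hχc_smooth.of_le (mod_cast le_top)) (A := fun _ => B0 * c ^ s)
        (fun j hj => hχc_bds j (hj.trans hl) y) F k N hR hy').trans ?_
      have h2 : ∑ j ∈ Finset.range (l + 1), (l.choose j : ℝ) = 2 ^ l := by
        rw [← Nat.cast_sum, Nat.sum_range_choose]; norm_num
      have hsum : ∑ j ∈ Finset.range (l + 1), (l.choose j : ℝ) * (B0 * c ^ s) ≤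
          2 ^ s * B0 * c ^ s := by
        rw [← Finset.sum_mul, h2, ← mul_assoc]
        exact mul_le_mul_of_nonneg_right
          (mul_le_mul_of_nonneg_right (pow_le_pow_right₀ (by norm_num) hl) hB0) (by positivity)
      exact mul_le_mul_of_nonneg_right (mul_le_mul_of_nonneg_right hsum (by positivity))
        (apply_nonneg _ _)
  · -- constants: `2^s B0 c^s = 8^s B0 a⁻ˢ`, and monotonicity of the sup of seminorms
    have hsup : (Finset.Iic (k + N, l)).sup
        (schwartzSeminormFamily ℂ (Fin n → EuclideanSpace ℝ (Fin 4)) ℂ) F ≤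
        (Finset.Iic (s + N, s + N)).sup
          (schwartzSeminormFamily ℂ (Fin n → EuclideanSpace ℝ (Fin 4)) ℂ) F :=
      sup_Iic_schwartzSeminorm_mono ℂ (by omega) (by omega) F
    have h8 : (2 : ℝ) ^ s * B0 * c ^ s = 8 ^ s * B0 * a⁻¹ ^ s := by
      rw [hcs, show (8 : ℝ) = 2 * 4 by norm_num, mul_pow]; ring
    rw [h8]
    exact mul_le_mul_of_nonneg_left hsup (by positivity)

end Summit.QuantumFields.YangMills.Cruxes.HypercubicLimit.ConditionalMeanTelescoping

end
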